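import Literature.NumberTheory.DiophantineGeometry.WordModelSelfDuality
import Literature.NumberTheory.DiophantineGeometry.SymmetricSliceCharacter
import Mathlib.LinearAlgebra.BilinearForm.Orthogonal
import HarnessLib

/-!
# The orthogonal projection onto `HW_μ` in the word model and the slice matrix `N_M = M Π_μ`
# of a symmetric `GL_N`-commuting matrix

Continuation of `WordModelSelfDuality`. Since the dot product is nondegenerate on the
highest-weight space `HW_μ = hwSpace k N μ` of `(k^N)^{⊗D}` (`μ ⊢ D` with at most `N` parts,
characteristic zero), `k^{words} = HW_μ ⊕ HW_μ^⊥` (`isCompl_hwSpace_hwOrth`) and the orthogonal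
projection `Π_μ = hwProj` onto `HW_μ` is defined; it is self-adjoint (`hwProj_dotProduct`),
commutes with the permutations of the positions (`hwProj_wordPerm`) and with every symmetric
`GL_N`-commuting matrix `M` (`IsGLCommuting.hwProj_mulVec`: `M` preserves `HW_μ` and `HW_μ^⊥`).

The **slice matrix** `N_M := M Π_μ` (`hwSliceMat`) of such an `M` is then a SYMMETRIC matrix on
words all of whose rows and columns lie in `HW_μ`, i.e. an element of the symmetric slice
functions `symSlice (hwSpace k N μ)` (`IsGLCommuting.hwSliceMat_mem_symSlice`), the assignment
`M ↦ N_M` is equivariant for the simultaneous permutation of the positions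
(`hwSliceMat_submatrix_compPerm`), and `N_M ≠ 0` as soon as `M` moves a vector of `HW_μ`
(`hwSliceMat_ne_zero`). Together with `IsGLCommuting.exists_mulVec_ne_zero` this realises, for
the purpose of an upper bound, the summand `[K_π^{μ,μ}]^{⟨τ⟩} ⊗ Id` of the `GL(E) ⋊ ⟨τ⟩`-invariants
of `𝕊_π(E^* ⊗ E)` (Gesmundo–Ikenmeyer–Panova 2017, Lemma 23 and Thm. 24: the transposition `τ`
acts on `K_π^{μ,μ} = Hom_{𝔖_d}([π], [μ] ⊗ [μ])` by the swap of the factors, with invariants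
`Hom_{𝔖_d}([π], S²[μ])`) inside the coordinate model `symSlice (HW_μ) ≅ S²(HW_μ)`, `HW_μ ≅ S^μ`.

## References

* F. Gesmundo, C. Ikenmeyer, G. Panova, *Geometric complexity theory and matrix powering*,
  Diff. Geom. Appl. 55 (2017) = arXiv:1611.00827, §4, Lemma 23, Thm. 24.
  [GesmundoIkenmeyerPanova2017]
* W. Fulton, J. Harris, *Representation Theory*, GTM 129, §2.1 (`Sym²`), §6.2 (Lemma 6.22).
  [FultonHarrisGTM129]

## Mathlib and tree

Used from Mathlib: `LinearMap.BilinForm.orthogonal`,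
`LinearMap.BilinForm.isCompl_orthogonal_of_restrict_nondegenerate`, `dotProductBilin`,
`Submodule.projection` (`projection_apply_mem`, `projection_apply_of_mem_left/right`,
`projection_eq_self_sub_projection`), `LinearMap.toMatrix'`, `Matrix.toLin'`,
`Matrix.submatrix_mul_equiv`. From the tree: `eq_zero_of_forall_dotProduct_eq_zero`,
`IsGLCommuting` (`WordModelSelfDuality`), `symSlice` (`SymmetricSliceCharacter`), `compPerm`,
`wordPerm_single`.

## Design

`namespace Literature.NumberTheory.DiophantineGeometry`; the field `k` is explicit in `hwSpace`,
`hwOrth`, `hwProj`, `hwProjMat` (it cannot be inferred from a partition), implicit where a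
matrix `M` over `k` is an argument.
-/

noncomputable section

open scoped BigOperators Matrix

namespace Literature.NumberTheory.DiophantineGeometry

section Projection

variable (k : Type*) [Field k] [CharZero k] {N D : ℕ} (μ : Nat.Partition D)
  (hμ : μ.parts.card ≤ N)

/-- `HW_μ((k^N)^{⊗D})`, the highest-weight space of the weight of the partition `μ` in the word
model (abbreviation). Fulton–Harris §15.5. [folklore] -/
abbrev hwSpace (N : ℕ) {D : ℕ} (μ : Nat.Partition D) : Submodule k (Word N D → k) :=
  highestWeightSpace (wordRep k N D) (Weight.ofPartition N μ)

/-- The dot product on the word model as a Mathlib bilinear form (`dotProductBilin`).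
[folklore] -/
def dotForm (N D : ℕ) : LinearMap.BilinForm k (Word N D → k) :=
  dotProductBilin k k

omit [CharZero k] in
/-- Unfolding lemma for `dotForm`. [folklore] -/
@[simp]
theorem dotForm_apply (x y : Word N D → k) : dotForm k N D x y = x ⬝ᵥ y :=
  rfl

omit [CharZero k] in
/-- The dot product is a reflexive (symmetric) bilinear form. [folklore] -/
theorem isRefl_dotForm : (dotForm k N D).IsRefl := fun x y h => by
  rw [dotForm_apply] at h ⊢
  rwa [dotProduct_comm]

/-- The orthogonal `HW_μ^⊥` of the highest-weight space for the dot product. [folklore] -/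
def hwOrth (N : ℕ) {D : ℕ} (μ : Nat.Partition D) : Submodule k (Word N D → k) :=
  (dotForm k N D).orthogonal (hwSpace k N μ)

omit [CharZero k] in
/-- Membership in `HW_μ^⊥` (unfolding lemma). [folklore] -/
theorem mem_hwOrth_iff (y : Word N D → k) :
    y ∈ hwOrth k N μ ↔ ∀ x ∈ hwSpace k N μ, x ⬝ᵥ y = 0 := by
  simp only [hwOrth, LinearMap.BilinForm.mem_orthogonal_iff, dotForm_apply]

include hμ in
/-- **`k^{words} = HW_μ ⊕ HW_μ^⊥`**: the restriction of the dot product to `HW_μ` is nondegenerate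
(`eq_zero_of_forall_dotProduct_eq_zero`), so `HW_μ` and its orthogonal are complementary
(Mathlib `isCompl_orthogonal_of_restrict_nondegenerate`). [folklore] -/
theorem isCompl_hwSpace_hwOrth : IsCompl (hwSpace k N μ) (hwOrth k N μ) := by
  apply LinearMap.BilinForm.isCompl_orthogonal_of_restrict_nondegenerate (isRefl_dotForm k)
  constructor
  · rintro ⟨x, hx⟩ h
    refine Subtype.ext (eq_zero_of_forall_dotProduct_eq_zero μ hμ hx fun y hy => ?_)
    exact h ⟨y, hy⟩
  · rintro ⟨y, hy⟩ h
    refine Subtype.ext (eq_zero_of_forall_dotProduct_eq_zero μ hμ hy fun x hx => ?_)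
    have := h ⟨x, hx⟩
    change x ⬝ᵥ y = 0 at this
    rwa [dotProduct_comm]

/-- The **orthogonal projection `Π_μ`** onto `HW_μ` along `HW_μ^⊥`. [folklore] -/
def hwProj : (Word N D → k) →ₗ[k] (Word N D → k) :=
  (hwSpace k N μ).projection (hwOrth k N μ) (isCompl_hwSpace_hwOrth k μ hμ)

/-- `Π_μ` takes values in `HW_μ`. [folklore] -/
theorem hwProj_apply_mem (v : Word N D → k) : hwProj k μ hμ v ∈ hwSpace k N μ :=
  Submodule.projection_apply_mem _ v

/-- `Π_μ` is the identity on `HW_μ`. [folklore] -/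
theorem hwProj_of_mem {x : Word N D → k} (hx : x ∈ hwSpace k N μ) : hwProj k μ hμ x = x :=
  Submodule.projection_apply_of_mem_left _ hx

/-- `Π_μ` kills `HW_μ^⊥`. [folklore] -/
theorem hwProj_of_mem_hwOrth {y : Word N D → k} (hy : y ∈ hwOrth k N μ) :
    hwProj k μ hμ y = 0 :=
  Submodule.projection_apply_of_mem_right _ hy

/-- `v - Π_μ v ∈ HW_μ^⊥`. [folklore] -/
theorem sub_hwProj_mem_hwOrth (v : Word N D → k) : v - hwProj k μ hμ v ∈ hwOrth k N μ := by
  rw [hwProj, ← Submodule.projection_eq_self_sub_projection]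
  exact Submodule.projection_apply_mem _ v

/-- **The orthogonal projection is self-adjoint**: `⟨Π a, b⟩ = ⟨a, Π b⟩` (both equal
`⟨Π a, Π b⟩`). [folklore] -/
theorem hwProj_dotProduct (a b : Word N D → k) :
    hwProj k μ hμ a ⬝ᵥ b = a ⬝ᵥ hwProj k μ hμ b := by
  have ha := (mem_hwOrth_iff k μ _).mp (sub_hwProj_mem_hwOrth k μ hμ a) _
    (hwProj_apply_mem k μ hμ b)
  have hb := (mem_hwOrth_iff k μ _).mp (sub_hwProj_mem_hwOrth k μ hμ b) _
    (hwProj_apply_mem k μ hμ a)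
  rw [dotProduct_sub, sub_eq_zero] at ha hb
  rw [hb, dotProduct_comm a, ha, dotProduct_comm]

/-- **`Π_μ` commutes with the permutations of the positions** (they preserve `HW_μ`, the dot
product, hence `HW_μ^⊥`). [folklore] -/
theorem hwProj_wordPerm (τ : Equiv.Perm (Fin D)) (v : Word N D → k) :
    hwProj k μ hμ (wordPerm k τ v) = wordPerm k τ (hwProj k μ hμ v) := by
  have hdec : wordPerm k τ v =
      wordPerm k τ (hwProj k μ hμ v) + wordPerm k τ (v - hwProj k μ hμ v) := by
    rw [← map_add, add_sub_cancel]
  have h1 : hwProj k μ hμ (wordPerm k τ (hwProj k μ hμ v)) = wordPerm k τ (hwProj k μ hμ v) :=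
    hwProj_of_mem k μ hμ (wordPerm_mem_highestWeightSpace τ (hwProj_apply_mem k μ hμ v))
  have h2 : hwProj k μ hμ (wordPerm k τ (v - hwProj k μ hμ v)) = 0 := by
    apply hwProj_of_mem_hwOrth
    rw [mem_hwOrth_iff]
    intro x hx
    rw [← dotProduct_wordPerm k τ⁻¹, ← LinearMap.comp_apply, ← wordPerm_mul, inv_mul_cancel,
      wordPerm_one, LinearMap.id_apply]
    exact (mem_hwOrth_iff k μ _).mp (sub_hwProj_mem_hwOrth k μ hμ v) _
      (wordPerm_mem_highestWeightSpace τ⁻¹ hx)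
  rw [hdec, map_add, h1, h2, add_zero]

variable {k}

omit [CharZero k] in
/-- Bridge to the action: a matrix on words commutes with all Kronecker powers iff its action
commutes with `wordRep` (`IsGLCommuting` is membership in the commutant of the `GL_N`-action).
[folklore] -/
theorem isGLCommuting_iff_mulVec_wordRep (M : Matrix (Word N D) (Word N D) k) :
    IsGLCommuting k M ↔ ∀ (g : GL (Fin N) k) (x : Word N D → k),
      M *ᵥ wordRep k N D g x = wordRep k N D g (M *ᵥ x) := by
  refine ⟨fun hM g x => hM.mulVec_wordRep g x, fun h g => ?_⟩
  apply Matrix.toLin'.injective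
  refine LinearMap.ext fun x => ?_
  rw [Matrix.toLin'_apply, Matrix.toLin'_apply, ← Matrix.mulVec_mulVec, ← Matrix.mulVec_mulVec,
    ← wordRep_eq_mulVec, ← wordRep_eq_mulVec, h]

omit [CharZero k] in
/-- A symmetric `GL_N`-commuting matrix preserves `HW_μ^⊥` (it is self-adjoint and preserves
`HW_μ`). [folklore] -/
theorem IsGLCommuting.mulVec_mem_hwOrth {M : Matrix (Word N D) (Word N D) k}
    (hM : IsGLCommuting k M) (hMt : Mᵀ = M) {y : Word N D → k} (hy : y ∈ hwOrth k N μ) :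
    M *ᵥ y ∈ hwOrth k N μ := by
  rw [mem_hwOrth_iff] at hy ⊢
  intro x hx
  rw [← dotProduct_mulVec_of_transpose_eq hMt]
  exact hy _ (hM.mulVec_mem_highestWeightSpace hx)

/-- **A symmetric `GL_N`-commuting matrix commutes with `Π_μ`** (it preserves both summands of
`HW_μ ⊕ HW_μ^⊥`). Gesmundo–Ikenmeyer–Panova Lemma 23 (the transposition preserves the
`GL(E)`-invariant subspace). [cite: GesmundoIkenmeyerPanova2017, §4 Lemma 23] -/
theorem IsGLCommuting.hwProj_mulVec {M : Matrix (Word N D) (Word N D) k}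
    (hM : IsGLCommuting k M) (hMt : Mᵀ = M) (v : Word N D → k) :
    hwProj k μ hμ (M *ᵥ v) = M *ᵥ hwProj k μ hμ v := by
  have hdec : M *ᵥ v = M *ᵥ hwProj k μ hμ v + M *ᵥ (v - hwProj k μ hμ v) := by
    rw [← Matrix.mulVec_add, add_sub_cancel]
  rw [hdec, map_add,
    hwProj_of_mem k μ hμ (hM.mulVec_mem_highestWeightSpace (hwProj_apply_mem k μ hμ v)),
    hwProj_of_mem_hwOrth k μ hμ (hM.mulVec_mem_hwOrth μ hMt (sub_hwProj_mem_hwOrth k μ hμ v)),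
    add_zero]

variable (k)

/-- The matrix of the orthogonal projection `Π_μ` in the word basis. [folklore] -/
def hwProjMat : Matrix (Word N D) (Word N D) k :=
  LinearMap.toMatrix' (hwProj k μ hμ)

/-- `Π_μ` (matrix) acts as `Π_μ` (linear map). [folklore] -/
theorem hwProjMat_mulVec (v : Word N D → k) : hwProjMat k μ hμ *ᵥ v = hwProj k μ hμ v := by
  rw [hwProjMat, ← Matrix.toLin'_apply, Matrix.toLin'_toMatrix']

/-- Entries of the projection matrix: `Π_{u v} = (Π e_v)(u)`. [folklore] -/
theorem hwProjMat_apply (u v : Word N D) :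
    hwProjMat k μ hμ u v = hwProj k μ hμ (Pi.single v (1 : k)) u := by
  rw [← hwProjMat_mulVec, Matrix.mulVec_single_one]
  rfl

/-- Entries of the projection matrix as pairings: `Π_{u v} = ⟨e_u, Π e_v⟩`. [folklore] -/
theorem hwProjMat_apply_eq_dotProduct (u v : Word N D) :
    hwProjMat k μ hμ u v =
      (Pi.single u (1 : k) : Word N D → k) ⬝ᵥ hwProj k μ hμ (Pi.single v 1) := by
  rw [hwProjMat_apply, single_dotProduct, one_mul]

/-- **The projection matrix is symmetric** (`Π_μ` is self-adjoint). [folklore] -/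
theorem hwProjMat_transpose : (hwProjMat k μ hμ)ᵀ = hwProjMat k μ hμ := by
  ext u v
  rw [Matrix.transpose_apply, hwProjMat_apply_eq_dotProduct, hwProjMat_apply_eq_dotProduct,
    ← hwProj_dotProduct, dotProduct_comm]

/-- The projection matrix is invariant under the simultaneous permutation of the positions in
both indices (`Π_μ` commutes with `𝔖_D`). [folklore] -/
theorem hwProjMat_submatrix_compPerm (τ : Equiv.Perm (Fin D)) :
    (hwProjMat k μ hμ).submatrix (compPerm τ) (compPerm τ) = hwProjMat k μ hμ := by
  ext u v
  rw [Matrix.submatrix_apply, compPerm_apply, compPerm_apply, hwProjMat_apply, hwProjMat_apply]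
  have h1 : (Pi.single (v ∘ ⇑τ) (1 : k) : Word N D → k) = wordPerm k τ⁻¹ (Pi.single v 1) := by
    rw [wordPerm_single, inv_inv]
  rw [h1, hwProj_wordPerm, wordPerm_apply]
  have hu : (u ∘ ⇑τ) ∘ ⇑τ⁻¹ = u := funext fun p => by simp
  rw [hu]

variable {k}

/-- A symmetric `GL_N`-commuting matrix commutes with the projection matrix. [folklore] -/
theorem IsGLCommuting.hwProjMat_mul {M : Matrix (Word N D) (Word N D) k}
    (hM : IsGLCommuting k M) (hMt : Mᵀ = M) : hwProjMat k μ hμ * M = M * hwProjMat k μ hμ := by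
  apply Matrix.toLin'.injective
  refine LinearMap.ext fun v => ?_
  rw [Matrix.toLin'_apply, Matrix.toLin'_apply, ← Matrix.mulVec_mulVec, ← Matrix.mulVec_mulVec,
    hwProjMat_mulVec, hwProjMat_mulVec, hM.hwProj_mulVec μ hμ hMt]

/-- **The slice matrix `N_M = M Π_μ`** of a matrix `M` on words: for `M` symmetric and
`GL_N`-commuting it is the image of `M` in the symmetric square of `HW_μ`
(`IsGLCommuting.hwSliceMat_mem_symSlice`), the coordinate form of the projection of
`End_{GL(E)}(E^{⊗D})^{sym}` to the summand `[K^{μ,μ}]^{⟨τ⟩} ⊗ Id_{𝕊_μE}` of GIP Thm. 24.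
[cite: GesmundoIkenmeyerPanova2017, §4 Thm. 24] -/
def hwSliceMat (M : Matrix (Word N D) (Word N D) k) : Matrix (Word N D) (Word N D) k :=
  M * hwProjMat k μ hμ

/-- `N_M v = M (Π_μ v)`. [folklore] -/
theorem hwSliceMat_mulVec (M : Matrix (Word N D) (Word N D) k) (v : Word N D → k) :
    hwSliceMat μ hμ M *ᵥ v = M *ᵥ hwProj k μ hμ v := by
  rw [hwSliceMat, ← Matrix.mulVec_mulVec, hwProjMat_mulVec]

/-- The columns of `N_M` are `M (Π_μ e_v)`. [folklore] -/
theorem hwSliceMat_col (M : Matrix (Word N D) (Word N D) k) (v : Word N D) :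
    (fun u => hwSliceMat μ hμ M u v) = M *ᵥ hwProj k μ hμ (Pi.single v 1) := by
  rw [← hwSliceMat_mulVec, Matrix.mulVec_single_one]
  rfl

/-- `N_M` is symmetric for `M` symmetric and `GL_N`-commuting (`(M Π)ᵀ = Π M = M Π`). [folklore] -/
theorem IsGLCommuting.hwSliceMat_transpose {M : Matrix (Word N D) (Word N D) k}
    (hM : IsGLCommuting k M) (hMt : Mᵀ = M) : (hwSliceMat μ hμ M)ᵀ = hwSliceMat μ hμ M := by
  rw [hwSliceMat, Matrix.transpose_mul, hwProjMat_transpose, hMt, hM.hwProjMat_mul μ hμ hMt]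

/-- **`N_M` lies in the symmetric slice functions of `HW_μ`**: its columns `M (Π_μ e_v)` lie in
`HW_μ` (`M` preserves `HW_μ`), and it is symmetric. GIP Thm. 24 (`[𝕊_πV]^𝒮 = ⊕ sK ⊗ Id`).
[cite: GesmundoIkenmeyerPanova2017, §4 Thm. 24] -/
theorem IsGLCommuting.hwSliceMat_mem_symSlice {M : Matrix (Word N D) (Word N D) k}
    (hM : IsGLCommuting k M) (hMt : Mᵀ = M) :
    (fun p : Word N D × Word N D => hwSliceMat μ hμ M p.1 p.2) ∈ symSlice (hwSpace k N μ) := by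
  have hcol : ∀ v, (fun u => hwSliceMat μ hμ M u v) ∈ hwSpace k N μ := fun v => by
    rw [hwSliceMat_col]
    exact hM.mulVec_mem_highestWeightSpace (hwProj_apply_mem k μ hμ _)
  have hsym : ∀ u v, hwSliceMat μ hμ M u v = hwSliceMat μ hμ M v u := fun u v => by
    conv_rhs => rw [← hM.hwSliceMat_transpose μ hμ hMt, Matrix.transpose_apply]
  refine ⟨⟨fun v => hcol v, fun u => ?_⟩, fun p => hsym _ _⟩
  have : (fun v => hwSliceMat μ hμ M u v) = fun v => hwSliceMat μ hμ M v u := funext (hsym u)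
  rw [this]
  exact hcol u

omit [CharZero k] in
/-- The simultaneous permutation of the positions is multiplicative on matrices indexed by
words (`Matrix.submatrix_mul_equiv`). [folklore] -/
theorem submatrix_compPerm_mul (M M' : Matrix (Word N D) (Word N D) k) (τ : Equiv.Perm (Fin D)) :
    (M * M').submatrix (compPerm τ) (compPerm τ) =
      M.submatrix (compPerm τ) (compPerm τ) * M'.submatrix (compPerm τ) (compPerm τ) :=
  (Matrix.submatrix_mul_equiv M M' _ (compPerm τ) _).symm

/-- **Equivariance of `M ↦ N_M`** under the simultaneous permutation of the positions
(`Π_μ` commutes with `𝔖_D`). [folklore] -/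
theorem hwSliceMat_submatrix_compPerm (M : Matrix (Word N D) (Word N D) k)
    (τ : Equiv.Perm (Fin D)) :
    hwSliceMat μ hμ (M.submatrix (compPerm τ) (compPerm τ)) =
      (hwSliceMat μ hμ M).submatrix (compPerm τ) (compPerm τ) := by
  rw [hwSliceMat, hwSliceMat, submatrix_compPerm_mul, hwProjMat_submatrix_compPerm]

/-- **Nonvanishing**: if `M` moves a vector `x ∈ HW_μ` then `N_M ≠ 0` (`N_M x = M x`).
[folklore] -/
theorem hwSliceMat_ne_zero {M : Matrix (Word N D) (Word N D) k} {x : Word N D → k}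
    (hx : x ∈ hwSpace k N μ) (hMx : M *ᵥ x ≠ 0) : hwSliceMat μ hμ M ≠ 0 := by
  intro h0
  apply hMx
  rw [← hwProj_of_mem k μ hμ hx, ← hwSliceMat_mulVec, h0, Matrix.zero_mulVec]

end Projection

end Literature.NumberTheory.DiophantineGeometry
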